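import Mathlib.Analysis.SpecialFunctions.Trigonometric.Bounds
import Summits.Ventures.HSemireg.WedgeHankelRecurrenceGaussPersymmetric

/-!
# Venture HSemireg — **WALL'S THEOREM ON CONSTANT CHAIN SEQUENCES, finite sections**: the constant sequence `(c, …, c)` of length `t ≥ 1` (`c > 0`) is a chain sequence with minimal parameters
# `g_0 = 0`, `0 < g_n < 1`, `c = (1 − g_{n−1}) g_n` IFF `4c cos²(π∕(t+2)) < 1` — the Chebyshev recurrence `(0, c)` has its zeros `2√c cos(kπ∕(t+2))` below `1` exactly then (Wall–Wetzel N372 +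
# N379); consequently `(c, c, …)` is a chain sequence of EVERY finite length iff `c ≤ 1∕4` (WALL); and the minimal parameters are minimal: any parameters `h` (`0 ≤ h_n < 1`) of the same sequence
# dominate `g` (Chihara III Thm 5.2)

HONEST FRAMING. Part of the Lean index of the computation cell `pub-hsemireg` (seat p10 gen 46, Sunday typer «UNIFORM-IN-n»).  Real sequences, `Real.sqrt`, `Real.cos` and one Archimedean choice
only; no variety, no cohomology theory, no sheaf, no Ext group and no semiregularity map is constructed here; nothing here says that HC / HC_CM / HC_AV holds; no Literature fact (unproved `Prop`) is
declared or used.  Custodian versions as in `WedgeHankelSiegelIdeal` (1/3).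
SOURCES (cited).  H. S. Wall, *Analytic Theory of Continued Fractions* (1948), Thm 19.1 ∕ §20 (the constant chain sequence `1∕4`); T. S. Chihara, *An Introduction to Orthogonal Polynomials* (1978),
Ch. III §5: Thm 5.2 (minimal parameters are minimal), Thm 5.3 ∕ Ex. 5.4 (`(1∕4, 1∕4, …)` and its maximality), Ch. IV Ex. 2.4; M. E. H. Ismail, *Classical and Quantum Orthogonal Polynomials*
(2005), Thm 7.2.4–7.2.5.
PROOF TYPED HERE.  N379 `constant_recurrence_zeros` gives the recurrence `(0, c)` with zeros `2√c cos((t+1−k)π∕(t+2))`; N372 `zeros_lt_of_chain` ∕ `chain_of_zeros_lt` with `B = 1` translate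
«parameters exist» into «top zero `< 1`», i.e. `2√c cos(π∕(t+2)) < 1`; squaring.  For Wall's `1∕4`: `cos² < 1` one way, `cos(π∕(t+2)) ≥ 1 − 2∕(t+2)` (Mathlib `Real.one_sub_mul_le_cos`) and an
Archimedean `t` the other way.  Minimality by induction: `g_{n+1} (1 − g_n) = h_{n+1}(1 − h_n)`, `1 − g_n ≥ 1 − h_n > 0`.
DEDUP DISCLOSURE (`rg -n -i 'constant_chain|wall_quarter_iff|chain_params_minimal' Summits/Ventures/HSemireg`, 2026-09-03): N372 `zeros_lt_of_wall_quarter` is the sufficiency half for general data;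
the `iff` with `cos²`, Wall's `1∕4` characterisation and the minimality lemma are new.  The 4 names below: 0 hits tree-wide.

WHAT IS IN THE TREE.  N372 `zeros_lt_of_chain`, `chain_of_zeros_lt`; N379 `constant_recurrence_zeros`; Mathlib `Real.one_sub_mul_le_cos`, `Real.cos_pos_of_mem_Ioo`, `Nat.exists_nat_gt` ∕ `exists_nat_gt`.
THIS FILE (namespace `Summit.Ventures.HSemireg.Wedge.HankelOuter` continued; CHAINED on N382 (import only); 0 definitions):
* §1148 `chain_params_minimal` (Chihara III Thm 5.2, finite), **`constant_chain_sequence_iff`** (`∃` minimal parameters of length `t` ⇔ `4c cos²(π∕(t+2)) < 1`), `constant_chain_sequence_of_le_quarter`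
  (`c ≤ 1∕4` ⇒ parameters for every `t`), **`wall_quarter_iff`** (WALL: parameters for every `t ≥ 1` ⇔ `c ≤ 1∕4`).
CAVEATS.  Finite sections with the normalisation `g_0 = 0` (minimal parameters); the infinite theory (maximal parameters, Wall's continued fraction) is not typed.  Nothing Ext-side.  New names only.
-/

open Module Polynomial Real
open scoped Matrix Polynomial

namespace Summit.Ventures.HSemireg.Wedge.HankelOuter

/-! ## §1148. Constant chain sequences (Wall) -/

/-- **MINIMAL PARAMETERS ARE MINIMAL (finite form)**: if `g` and `h` are parameter sequences of the same chain sequence up to `t` — `(1 − g_n) g_{n+1} = (1 − h_n) h_{n+1}` (`n + 1 ≤ t`) — with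
`g_n < 1`, `0 ≤ h_n < 1` and `g_0 ≤ h_0`, then `g_n ≤ h_n` for all `n ≤ t`. [Chihara III Thm 5.2; this file, §1148] -/
theorem chain_params_minimal {g h : ℕ → ℝ} {t : ℕ} (hg : ∀ n, n ≤ t → g n < 1) (hh : ∀ n, n ≤ t → 0 ≤ h n ∧ h n < 1) (h0 : g 0 ≤ h 0)
    (heq : ∀ n, n + 1 ≤ t → (1 - g n) * g (n + 1) = (1 - h n) * h (n + 1)) : ∀ n, n ≤ t → g n ≤ h n := by
  intro n
  induction n with
  | zero => exact fun _ => h0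
  | succ n ih =>
    intro hn
    have hgn := ih (by omega)
    have h1 : 0 < 1 - g n := by linarith [hg n (by omega)]
    have h2 : 0 < 1 - h n := by linarith [(hh n (by omega)).2]
    have h3 := (hh (n + 1) hn).1
    have h4 := heq n hn
    -- `g_{n+1} (1 − g_n) = h_{n+1} (1 − h_n) ≤ h_{n+1} (1 − g_n)`
    nlinarith [mul_le_mul_of_nonneg_left (show 1 - h n ≤ 1 - g n by linarith) h3]

/-- **THE CONSTANT CHAIN SEQUENCE OF LENGTH `t`: parameters exist IFF `4c cos²(π∕(t+2)) < 1`** (`t ≥ 1`, `c > 0`; normalisation `g_0 = 0`, `0 < g_n < 1`). [Wall 1948 Thm 19.1 (cf.); Chihara III §5,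
IV Ex. 2.4; N372; this file, §1148] -/
theorem constant_chain_sequence_iff {c : ℝ} (hc : 0 < c) {t : ℕ} (ht : 1 ≤ t) :
    (∃ g : ℕ → ℝ, g 0 = 0 ∧ (∀ n, n + 1 ≤ t → 0 < g (n + 1) ∧ g (n + 1) < 1) ∧ ∀ n, n + 1 ≤ t → c = (1 - g n) * g (n + 1)) ↔
      4 * c * cos (π / ((t : ℝ) + 2)) ^ 2 < 1 := by
  obtain ⟨Q, hQ0, hQ1, hQrec, hz, hQprod⟩ := constant_recurrence_zeros hc 0 t
  have hbQ : ∀ j : ℕ, 0 < (fun _ : ℕ => (2 * Real.sqrt c) ^ 2 * (1 / 4 : ℝ)) j := fun _ => by positivity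
  have hsq : (2 * Real.sqrt c) ^ 2 * (1 / 4 : ℝ) = c := by rw [mul_pow, sq_sqrt hc.le]; ring
  have hcos : 0 < cos (π / ((t : ℝ) + 2)) := by
    refine cos_pos_of_mem_Ioo ⟨by linarith [pi_pos, show 0 < π / ((t : ℝ) + 2) by positivity], ?_⟩
    rw [div_lt_div_iff_of_pos_left pi_pos (by positivity) two_pos]
    have : (1 : ℝ) ≤ t := by exact_mod_cast ht
    linarith
  have hlast : 2 * Real.sqrt c * cos ((((Fin.rev (Fin.last t) : Fin (t + 1)) : ℝ) + 1) * π / ((t : ℝ) + 2)) + 0 = 2 * Real.sqrt c * cos (π / ((t : ℝ) + 2)) := by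
    rw [Fin.rev_last, Fin.val_zero, Nat.cast_zero, zero_add, one_mul, add_zero]
  -- root ↔ node
  have hroots : ∀ s, (Q (t + 1)).eval s = 0 ↔ ∃ k : Fin (t + 1), s = 2 * Real.sqrt c * cos ((((Fin.rev k : Fin (t + 1)) : ℝ) + 1) * π / ((t : ℝ) + 2)) + 0 := fun s => by
    rw [hQprod, eval_prod, Finset.prod_eq_zero_iff]
    simp only [Finset.mem_univ, true_and, eval_sub, eval_X, eval_C, sub_eq_zero]
  have hsqrt : (2 * Real.sqrt c * cos (π / ((t : ℝ) + 2))) ^ 2 = 4 * c * cos (π / ((t : ℝ) + 2)) ^ 2 := by rw [mul_pow, mul_pow, sq_sqrt hc.le]; ring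
  have hnn : 0 ≤ 2 * Real.sqrt c * cos (π / ((t : ℝ) + 2)) := by positivity
  constructor
  · rintro ⟨g, hg0, hg, hgc⟩
    have hlt := zeros_lt_of_chain (q := Q) (a := fun _ => 2 * Real.sqrt c * 0 + 0) (b := fun _ => (2 * Real.sqrt c) ^ 2 * (1 / 4 : ℝ)) hQ0 hQ1 hQrec hbQ (t := t) (B := 1) (g := g)
      (fun n _ => by norm_num)
      (fun n hn => by
        rcases n with _ | k
        · rw [hg0]; exact ⟨le_rfl, one_pos⟩
        · exact ⟨(hg k hn).1.le, (hg k hn).2⟩)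
      (fun n hn => by rw [hsq]; simp only [mul_zero, add_zero, sub_zero, mul_one]; exact (hgc n hn).le)
    have htop := hlt _ ((hroots _).2 ⟨Fin.last t, rfl⟩)
    rw [hlast] at htop
    rw [← hsqrt]
    nlinarith
  · intro h4
    have htop : 2 * Real.sqrt c * cos (π / ((t : ℝ) + 2)) < 1 := by nlinarith
    have hall : ∀ s, (Q (t + 1)).eval s = 0 → s < 1 := fun s hs => by
      obtain ⟨k, rfl⟩ := (hroots s).1 hs
      refine lt_of_le_of_lt (hz.monotone (Fin.le_last k)) ?_
      rw [hlast]; exact htop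
    obtain ⟨-, g, hg0, hg, hgb⟩ := chain_of_zeros_lt (q := Q) (a := fun _ => 2 * Real.sqrt c * 0 + 0) (b := fun _ => (2 * Real.sqrt c) ^ 2 * (1 / 4 : ℝ)) hQ0 hQ1 hQrec hbQ hall
    refine ⟨g, hg0, hg, fun n hn => ?_⟩
    have := hgb n hn
    simp only [mul_zero, add_zero, sub_zero, mul_one] at this
    rw [← hsq]; exact this

/-- **`c ≤ 1∕4` ⇒ the constant sequence is a chain sequence of every length.** [Wall 1948; Chihara III Thm 5.3; this file, §1148] -/
theorem constant_chain_sequence_of_le_quarter {c : ℝ} (hc : 0 < c) (hc4 : c ≤ 1 / 4) {t : ℕ} (ht : 1 ≤ t) :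
    ∃ g : ℕ → ℝ, g 0 = 0 ∧ (∀ n, n + 1 ≤ t → 0 < g (n + 1) ∧ g (n + 1) < 1) ∧ ∀ n, n + 1 ≤ t → c = (1 - g n) * g (n + 1) := by
  refine (constant_chain_sequence_iff hc ht).2 ?_
  have hcos : cos (π / ((t : ℝ) + 2)) ^ 2 < 1 := by
    have h1 : cos (π / ((t : ℝ) + 2)) < 1 := by
      have hne : cos (π / ((t : ℝ) + 2)) ≠ 1 := fun h => by
        rw [cos_eq_one_iff_of_lt_of_lt (by linarith [pi_pos, show 0 < π / ((t : ℝ) + 2) by positivity])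
          (by rw [div_lt_iff₀ (by positivity)]; nlinarith [pi_pos])] at h
        exact (div_pos pi_pos (by positivity)).ne' h
      exact lt_of_le_of_ne (cos_le_one _) hne
    have h2 : -1 < cos (π / ((t : ℝ) + 2)) := lt_of_lt_of_le (by norm_num) (cos_pos_of_mem_Ioo ⟨by linarith [pi_pos, show 0 < π / ((t : ℝ) + 2) by positivity],
      by rw [div_lt_div_iff_of_pos_left pi_pos (by positivity) two_pos]; have : (1 : ℝ) ≤ t := (by exact_mod_cast ht); linarith⟩).le
    nlinarith
  nlinarith

/-- **WALL'S THEOREM (finite sections): the constant sequence `c > 0` admits minimal chain parameters of every length `t ≥ 1` IFF `c ≤ 1∕4`.** [Wall 1948 Thm 19.1 ∕ §20; Chihara III Thm 5.3,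
Ex. 5.4; this file, §1148] -/
theorem wall_quarter_iff {c : ℝ} (hc : 0 < c) :
    (∀ t : ℕ, 1 ≤ t → ∃ g : ℕ → ℝ, g 0 = 0 ∧ (∀ n, n + 1 ≤ t → 0 < g (n + 1) ∧ g (n + 1) < 1) ∧ ∀ n, n + 1 ≤ t → c = (1 - g n) * g (n + 1)) ↔ c ≤ 1 / 4 := by
  constructor
  · intro h
    by_contra hlt
    rw [not_le] at hlt
    -- choose `t` with `4 ∕ (t + 2) < 1 − 1∕(4c)`; then `4c cos²(π∕(t+2)) ≥ 4c (1 − 2∕(t+2))² ≥ 4c (1 − 4∕(t+2)) > 1`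
    have hδ : 0 < 1 - 1 / (4 * c) := by rw [sub_pos, div_lt_one (by positivity)]; linarith
    obtain ⟨t, htgt⟩ := exists_nat_gt (4 / (1 - 1 / (4 * c)))
    have ht1 : 1 ≤ t + 1 := by omega
    have hkey := (constant_chain_sequence_iff hc ht1).1 (h (t + 1) ht1)
    have hT : (0 : ℝ) < ((t + 1 : ℕ) : ℝ) + 2 := by positivity
    have hcosge : 1 - 2 / π * (π / ((((t + 1 : ℕ)) : ℝ) + 2)) ≤ cos (π / ((((t + 1 : ℕ)) : ℝ) + 2)) :=
      one_sub_mul_le_cos (by positivity) (by rw [div_le_div_iff_of_pos_left pi_pos hT two_pos]; linarith)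
    have hsimp : 1 - 2 / π * (π / ((((t + 1 : ℕ)) : ℝ) + 2)) = 1 - 2 / ((((t + 1 : ℕ)) : ℝ) + 2) := by field_simp
    rw [hsimp] at hcosge
    have hu : 0 ≤ 1 - 2 / ((((t + 1 : ℕ)) : ℝ) + 2) := by
      rw [sub_nonneg, div_le_one hT]; push_cast; linarith
    have hcos2 : (1 - 2 / ((((t + 1 : ℕ)) : ℝ) + 2)) ^ 2 ≤ cos (π / ((((t + 1 : ℕ)) : ℝ) + 2)) ^ 2 := pow_le_pow_left₀ hu hcosge 2
    have hfrac : 4 / ((((t + 1 : ℕ)) : ℝ) + 2) < 1 - 1 / (4 * c) := by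
      have h4 : 4 < (t : ℝ) * (1 - 1 / (4 * c)) := by rwa [div_lt_iff₀ hδ] at htgt
      rw [div_lt_iff₀ hT]; push_cast; nlinarith
    -- `(1 − u)² ≥ 1 − 2u` with `u = 2∕(T)`: so `cos² ≥ 1 − 4∕T > 1∕(4c)`
    have h1 : 1 - 4 / ((((t + 1 : ℕ)) : ℝ) + 2) ≤ (1 - 2 / ((((t + 1 : ℕ)) : ℝ) + 2)) ^ 2 := by
      have e : (1 - 2 / ((((t + 1 : ℕ)) : ℝ) + 2)) ^ 2 = 1 - 4 / ((((t + 1 : ℕ)) : ℝ) + 2) + (2 / ((((t + 1 : ℕ)) : ℝ) + 2)) ^ 2 := by ring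
      rw [e]; nlinarith [sq_nonneg (2 / ((((t + 1 : ℕ)) : ℝ) + 2))]
    have h2 : 1 / (4 * c) < cos (π / ((((t + 1 : ℕ)) : ℝ) + 2)) ^ 2 := by linarith
    rw [div_lt_iff₀ (by positivity)] at h2
    linarith
  · intro h t ht
    exact constant_chain_sequence_of_le_quarter hc h ht

end Summit.Ventures.HSemireg.Wedge.HankelOuter
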